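import Summits.CriticalPhenomena.CardyFormulaZ2.Theorems.CardyIKTransportIKLinearTransportWallDominationPlanarDefs
import Summits.CriticalPhenomena.CardyFormulaZ2.Theorems.CardyIKTransportIKLinearTransportWallDominationRingMargin
import Summits.CriticalPhenomena.CardyFormulaZ2.Theorems.CardyIKTransportIKLinearTransportHardCrossingDecay

/-!
# `CardyIKTransport.IKLinearTransport` (stmt-CriticalPhenomena-5076), line `pinned-diagram-exchange`, lead c8 —
# WALL DOMINATION, planar transfer (ASSEMBLY): THIN RINGS AROUND WALL SEGMENTS IN THE PLANE FOR THE ISOTROPIC MODEL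

Support file (`--supports stmt-CriticalPhenomena-5076`, registered sub-goal `thinRing_planar_iso_of`).  The sorry-free composition of the wave-3
sub-goals of `…WallDominationPlanarDefs` with the landed inputs:
* `thinRingChain_margin_all` (`…WallDominationRingMargin`): the chained thin-ring event has slab probability `≥ c₀` for EVERY pattern, in
  particular the all-isotropic one — two-wall domination (the FKG substitute) + site-`𝕋` RSW/Harris;
* `CylPlane.cylProb_bandQ_le` (stmt-5911 transport): slab probability of a band event `≤ 2 ×` its planar free box probability;
* `nuMix_boxReadQ_eq_qProb` (p157161): the planar free box probability IS the `ν_S`-probability of the box reading;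
* `pureIK_hardCrossing_decay_tb` (p149831): hard (long-way) crossings of the isotropic model decay geometrically in the aspect ratio.

RESULT (`thinRing_planar_iso_of`; unconditional once the five sub-goals land): there are `N, j` and `c > 0` such that for every `s ≥ N`
and every position `(a, b)`, with `ν_univ`-probability `≥ c` NO WHITE PATH of the isotropic Izergin–Korepin cell model meeting the wall
segment `{a} × [b, b+s)` reaches sup-distance `2M + 3s`, `M = (2j+1)(s+1)` — the ring clause of `stub_ringAll` for thin boxes in thick
neighbourhoods, for a model WITHOUT positive association.  ARITHMETIC: with `q` the planar probability of the box thin-ring event,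
`c₀ ≤ cyl(thin ring) ≤ cyl(band part in ThinRingQ) + Σ_{4 margins} cyl(margin crossed) ≤ 2q + 4 · 2 · ½ (3/4)^j ≤ 2q + c₀/2`, so `q ≥ c₀/4`.
-/

noncomputable section

namespace Summit.CriticalPhenomena.CardyFormulaZ2.Theorems.IKLinearTransport.PinnedDiagramExchange.WallDomination

open scoped BigOperators Classical
open MeasureTheory
open Summit.CriticalPhenomena.CardyFormulaZ2.Cruxes.IKMixedBoxCrossing.DefectClosureExploration
open Summit.CriticalPhenomena.CardyFormulaZ2.Theorems.IKLinearTransport.PinnedDiagramExchange (Obs monoPaths farFrom cellGraph tbCross νmix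
  isProbabilityMeasure_nuMix)
open Summit.CriticalPhenomena.CardyFormulaZ2.Theorems.IKLinearTransport.PinnedDiagramExchange.HardCrossingDecay (pureIK_hardCrossing_decay_tb)
open Summit.CriticalPhenomena.CardyFormulaZ2.Cruxes.IKMixedBoxCrossing.PairedMirrorExploration (pTB)

namespace PlanarStub

/-- Slab probabilities are subadditive over finite indexed unions (indicator of a union ≤ sum of indicators). -/
theorem cylProb_iUnion_le {ι : Type*} [Fintype ι] {w L : ℕ} [NeZero L] (τ : Fin w → Bool) (F : ι → Set (CylCfg w L)) :
    cylProb w L τ (⋃ i, F i) ≤ ∑ i, cylProb w L τ (F i) := by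
  unfold cylProb
  rw [← Finset.sum_div]
  refine div_le_div_of_nonneg_right ?_ (CylBunchStub.cylZ_nonneg w L τ)
  rw [Finset.sum_comm]
  refine Finset.sum_le_sum fun x _ => ?_
  have hW : 0 ≤ cylWeight w L τ x := CylBunchStub.cylWeight_nonneg w L τ x
  have hnn : ∀ j : ι, 0 ≤ (if x ∈ F j then cylWeight w L τ x else 0) := fun j => by
    split_ifs
    exacts [hW, le_rfl]
  by_cases hx : x ∈ ⋃ i, F i
  · obtain ⟨i, hi⟩ := Set.mem_iUnion.1 hx
    rw [if_pos hx]
    calc cylWeight w L τ x = (if x ∈ F i then cylWeight w L τ x else 0) := by rw [if_pos hi]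
      _ ≤ ∑ j, (if x ∈ F j then cylWeight w L τ x else 0) :=
          Finset.single_le_sum (fun j _ => hnn j) (Finset.mem_univ i)
  · rw [if_neg hx]
    exact Finset.sum_nonneg fun j _ => hnn j

/-- Slab probabilities are subadditive over the four-fold union of the exit event. -/
theorem cylProb_exit_le {s M L : ℕ} [NeZero L] (τ : Fin (s + s) → Bool) :
    cylProb (s + s) L τ (ExitCyl s M L) ≤ ∑ i : Fin 4, cylProb (s + s) L τ
      ((CylPlane.bandQ L (2 * M + 3 * s - 1) : CylCfg (s + s) L → CylPlane.Q (s + s) (2 * M + 3 * s - 1)) ⁻¹' MarginQ s M i) :=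
  cylProb_iUnion_le τ _

end PlanarStub

open PlanarStub in
/-- **THIN RINGS AROUND WALL SEGMENTS IN THE PLANE, ISOTROPIC MODEL, THICK NEIGHBOURHOOD — from the five wave-3 sub-goals** (registered
sub-goal `thinRing_planar_iso_of`; see the file header for the route and the arithmetic). -/
theorem thinRing_planar_iso_of : ThinRingCylSubset → ThinRingQ_planar → MarginQ_planar → ThinRingObs_shift → ThinRingObs_ring →
    ∃ (N j : ℕ) (c : ℝ), 0 < c ∧ ∀ (s : ℕ) (a b : ℤ), N ≤ s →
      c ≤ (νmix Set.univ).real (RingSeg a b s (2 * ((2 * j + 1) * (s + 1)) + 3 * s)) := by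
  intro hCyl hQ hMQ hShift hRing
  obtain ⟨c₀, hc₀, hmargin⟩ := thinRingChain_margin_all
  obtain ⟨N, hN⟩ := pureIK_hardCrossing_decay_tb (1 / 2) (by norm_num)
  obtain ⟨j, hj⟩ := exists_pow_lt_of_lt_one (show 0 < c₀ / 8 by positivity) (show (3 : ℝ) / 4 < 1 by norm_num)
  refine ⟨N + 1, j, c₀ / 4, by positivity, fun s a b hs => ?_⟩
  have hs1 : 1 ≤ s := by omega
  haveI : IsProbabilityMeasure (νmix Set.univ) := isProbabilityMeasure_nuMix _
  -- the geometry
  set M : ℕ := (2 * j + 1) * (s + 1) with hM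
  set L : ℕ := 2 * M + 7 * s + 1 with hLdef
  haveI : NeZero L := ⟨by omega⟩
  have hLcut : L = (2 * M + 3 * s - 1) + 1 + (4 * s + 1) := by omega
  have hd : 2 * (s + s) + 1 ≤ 4 * s + 1 := by omega
  set τ : Fin (s + s) → Bool := fun _ => true with hτ
  have hτS : ∀ i : Fin (s + s), τ i = true ↔ ((i : ℕ) : ℤ) ∈ (Set.univ : Set ℤ) := fun i => by simp [hτ]
  -- STEP 1: the ring event contains the thin-ring event anchored at `(a - s, b - M - s)`
  have hsub : ThinRingObs (a - s) (b - M - s) s M ⊆ RingSeg a b s (2 * M + 3 * s) := by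
    have h := hRing (a - s) (b - M - s) s M hs1
    rwa [show (a : ℤ) - s + s = a by ring, show (b : ℤ) - M - s + M + s = b by ring] at h
  have step1 : (νmix Set.univ).real (ThinRingObs (a - s) (b - M - s) s M) ≤
      (νmix Set.univ).real (RingSeg a b s (2 * M + 3 * s)) := measureReal_mono hsub
  -- STEP 2–3: translation invariance, then the planar free box probability `q`
  have step23 : (νmix Set.univ).real (ThinRingObs (a - s) (b - M - s) s M) = CylPlane.qProb τ (ThinRingQ s M) := by
    rw [hShift, ← hQ s M hs1, nuMix_boxReadQ_eq_qProb Set.univ τ hτS]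
  -- STEP 4: `cyl(band part in ThinRingQ) ≤ 2 q`
  have step4 : cylProb (s + s) L τ ((CylPlane.bandQ L (2 * M + 3 * s - 1) : CylCfg (s + s) L →
      CylPlane.Q (s + s) (2 * M + 3 * s - 1)) ⁻¹' ThinRingQ s M) ≤ 2 * CylPlane.qProb τ (ThinRingQ s M) :=
    CylPlane.cylProb_bandQ_le hLcut hd τ _
  -- STEP 5–6: `c₀ ≤ cyl(thin ring) ≤ cyl(band part in ThinRingQ) + cyl(exit)`
  have step56 : c₀ ≤ cylProb (s + s) L τ ((CylPlane.bandQ L (2 * M + 3 * s - 1) : CylCfg (s + s) L →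
      CylPlane.Q (s + s) (2 * M + 3 * s - 1)) ⁻¹' ThinRingQ s M) + cylProb (s + s) L τ (ExitCyl s M L) :=
    (hmargin s M hs1 L rfl τ).trans ((CylPlane.cylProb_mono' τ (hCyl s M L hs1 rfl)).trans (CylPlane.cylProb_union_le τ _ _))
  -- STEP 7: each margin crossing costs at most `2 · ½ (3/4)^j`
  have step7 : ∀ i : Fin 4, cylProb (s + s) L τ ((CylPlane.bandQ L (2 * M + 3 * s - 1) : CylCfg (s + s) L →
      CylPlane.Q (s + s) (2 * M + 3 * s - 1)) ⁻¹' MarginQ s M i) ≤ 2 * (1 / 2 * ((1 + 1 / 2) / 2) ^ j) := by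
    intro i
    refine (CylPlane.cylProb_bandQ_le hLcut hd τ _).trans (mul_le_mul_of_nonneg_left ?_ zero_le_two)
    rw [← nuMix_boxReadQ_eq_qProb Set.univ τ hτS, hMQ s M hs1 i, nuMix_real_tbCross]
    have h := hN (s + 1) j (marginCorner s M i).1 (marginCorner s M i).2 (by omega)
    rwa [show (2 * j + 1) * (s + 1) = M from rfl] at h
  have hexit : cylProb (s + s) L τ (ExitCyl s M L) ≤ 4 * ((3 : ℝ) / 4) ^ j := by
    refine (cylProb_exit_le τ).trans ?_
    calc ∑ i : Fin 4, cylProb (s + s) L τ ((CylPlane.bandQ L (2 * M + 3 * s - 1) : CylCfg (s + s) L →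
          CylPlane.Q (s + s) (2 * M + 3 * s - 1)) ⁻¹' MarginQ s M i)
        ≤ ∑ _i : Fin 4, 2 * (1 / 2 * ((1 + 1 / 2) / 2) ^ j) := Finset.sum_le_sum fun i _ => step7 i
      _ = 4 * ((3 : ℝ) / 4) ^ j := by
          rw [Finset.sum_const, Finset.card_univ, Fintype.card_fin, nsmul_eq_mul]
          norm_num
          ring
  -- ARITHMETIC
  have hj' : 4 * ((3 : ℝ) / 4) ^ j ≤ c₀ / 2 := by linarith
  have hq : c₀ / 4 ≤ CylPlane.qProb τ (ThinRingQ s M) := by linarith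
  calc c₀ / 4 ≤ CylPlane.qProb τ (ThinRingQ s M) := hq
    _ = (νmix Set.univ).real (ThinRingObs (a - s) (b - M - s) s M) := step23.symm
    _ ≤ (νmix Set.univ).real (RingSeg a b s (2 * M + 3 * s)) := step1

end Summit.CriticalPhenomena.CardyFormulaZ2.Theorems.IKLinearTransport.PinnedDiagramExchange.WallDomination

end
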